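import Summits.BirchSwinnertonDyer.BirchSwinnertonDyer.Theorems.PrintX8VerticalStevensPeriods
import HarnessLib

/-!
# Route `PrintX8`, crux 20622 `MuBoundSmallImageX8` — LINE «vertical Stevens at 3»:
# the BRIDGE VS-B in the kernel — mod-`p` span of the `p`-power winding classes + `a_p ≢ 1 (mod p)`
# ⟹ the plus symbol of the newform is non-constant mod `p` on `ℤ[1/p]` (`CycWindingNonConstantAt`)

Cell `bsd-print-x8`, seat p1 (gen 4), `--supports stmt-BirchSwinnertonDyer-20622`.  Theorems only; no
named fact is taken as a hypothesis: every analytic input is a tree THEOREM (`cuspSymbol_mul_holds`,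
`modularSymbol_gamma0_smul_holds` — Manin 1972 Prop. 1.4 / Thm. 1.6; `plusSymbol_eq_re_holds`;
`ratCast_ratPlusSymbol_holds` — Manin–Drinfeld; `IsNewform0.plusPeriod_pos_…` / the period convention
`re Λ_f = ℤ·Ω⁺_f/2`; the Hecke relation `intCast_mul_ratPlusSymbol` — MTT (4.2)).

## The statement (cell memo `plan/vs/LINE-VERTICAL-STEVENS-AT-3.md` §4, referee R-65 (3) / R-68)

Let `f ∈ S₂(Γ₀(N))` be a normalised newform with rational coefficients, `p` an odd prime with `p ∤ N`
and `a_p(f) ≢ 1 (mod p)`.  Assume the MOD-`p` SPAN statement at `(N, p)` in generation form (the form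
kit j286420/j286464 certify and R-68 isolates; implied by `EisSpanGen N p`, `eisSpanMod_of_eisSpanGen`):
every `γ ∈ Γ_H(N)` (`d ≡ ±pᵏ mod N`, `InGammaH`) lies in
`⟨good ∪ finite-order ∪ trace ±2 ∪ p-th powers⟩ · [Γ₀(N), Γ₀(N)]`.  THEN there are `n, a, a'` with
`1 ≤ ‖[a/pⁿ]⁺_f − [a'/pⁿ]⁺_f‖_p` (`exists_one_le_norm_sub_of_spanMod`).  For the newform of an elliptic
curve this is `CycWindingNonConstantAt W p` given the span statement at the level of each of its newforms
(`cycWindingNonConstantAt_of_spanMod`); on class X8 (`a₃ = ±3`) the congruence hypothesis is automatic.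

## Proof (no homology interface is needed)

`Ψ(γ) := re{∞, γ∞}_f ∈ re Λ_f = ℤ·Ω⁺/2`; write `re{∞,γ∞} = m(γ)·Ω⁺/2`, `m(γ) ∈ ℤ`.  Then
* `m` is additive (`cuspSymbol_mul_holds`), kills finite-order elements, and kills trace-`±2` elements:
  `{∞, γ∞} = {∞, γs} − {∞, s} = 0` at the fixed cusp `s = (a−d)/2c` (Manin's relation
  `modularSymbol_gamma0_smul_holds`; for `c = 0` the period is `0` by definition);
* `[γr]⁺ − [r]⁺ = m(γ)/2` for every `r` with `cr + d ≠ 0`, and `[a/c]⁺ = m(γ)/2` if `c ≠ 0`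
  (`plusSymbol_eq_re_holds`, `ratCast_ratPlusSymbol_holds`);
* if ALL `[a/pⁿ]⁺ − [a'/pⁿ]⁺` had norm `< 1`, then `p ∣ m(γ)` for every good `γ` (`γ·0 = b/±pᵐ`), so the
  additive map `m̄ : Γ₀(N) → 𝔽_p` kills the span subgroup, hence (hypothesis) all of `Γ_H(N)`, hence is
  constant on `Γ_H(N)`-cosets;
* HECKE STEP: for `γ = (a b; c d)` with `c ≠ 0`, the relation `a_p[a/c]⁺ = Σⱼ[(a+jc)/pc]⁺ + [pa/c]⁺`
  has every term of the form `[u/w]⁺ = m(δ)/2` with `δ = (u *; w *) ∈ Γ₀(N)` and `d(δγ⁻¹) ≡ g ∈ {1, p, p⁻¹}`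
  (`g = gcd`), i.e. `δ ∈ Γ_H(N)·γ`; so `a_p m̄(γ) = (p+1) m̄(γ)`, `(a_p − 1) m̄(γ) = 0`, `m̄(γ) = 0`;
* so `p ∣ m(γ)` for all `γ`, i.e. `re Λ_f ⊆ ℤ·pΩ⁺/2`, contradicting `re Λ_f = ℤ·Ω⁺/2`, `Ω⁺ > 0`.

What is NOT here: the span statement itself (VS-0; THEOREM (T) at prime level is
`PrintX8VerticalStevensPrimeLevel.lean`), and the `p = 3` collapse to one colour (VS-G, seat p3).
-/

-- the summit namespace repeats `BirchSwinnertonDyer` by design (summit = problem); linter moot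
set_option linter.dupNamespace false
set_option autoImplicit false

noncomputable section

namespace Summit.BirchSwinnertonDyer.BirchSwinnertonDyer.Theorems.PrintX8VerticalStevens

open scoped MatrixGroups ModularForm

open CongruenceSubgroup Matrix Matrix.SpecialLinearGroup
  Literature.NumberTheory.EllipticCurves Literature.NumberTheory.EllipticCurves.ModularForms
  Literature.NumberTheory.EllipticCurves.Rank1Residual

section Bridge

variable {N : ℕ} [NeZero N] {f : CuspForm (Gamma0 N) 2} {p : ℕ} [Fact p.Prime]

/-- For an odd prime `p`: a half-integer `m/2` of `p`-adic norm `< 1` has `p ∣ m`. -/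
theorem dvd_of_norm_div_two_lt_one (hp2 : p ≠ 2) {m : ℤ}
    (h : ‖((((m : ℚ) / 2 : ℚ)) : ℚ_[p])‖ < 1) : (p : ℤ) ∣ m := by
  have hp : p.Prime := Fact.out
  have h2 : ‖((2 : ℤ) : ℚ_[p])‖ = 1 := by
    refine le_antisymm (Padic.norm_int_le_one 2) (not_lt.mp fun hlt ↦ ?_)
    rw [Padic.norm_intCast_lt_one_iff] at hlt
    have : (p : ℤ) ∣ 2 := hlt
    have hp2' : p ∣ 2 := by exact_mod_cast this
    exact hp2 ((Nat.prime_dvd_prime_iff_eq hp Nat.prime_two).mp hp2')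
  have hcast : ((((m : ℚ) / 2 : ℚ)) : ℚ_[p]) = ((m : ℤ) : ℚ_[p]) / ((2 : ℤ) : ℚ_[p]) := by
    push_cast; ring
  rw [hcast, norm_div, h2, div_one, Padic.norm_intCast_lt_one_iff] at h
  exact h

/-- **THE BRIDGE (level form).**  For a normalised newform `f ∈ S₂(Γ₀(N))` with rational coefficients,
an odd prime `p ∤ N` with `a_p(f) ≢ 1 (mod p)`, and the MOD-`p` SPAN statement at `(N, p)` (every
`γ ∈ Γ_H(N)` lies in `⟨good ∪ finite-order ∪ trace ±2 ∪ p-th powers⟩·[Γ₀(N),Γ₀(N)]`; implied by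
`EisSpanGen N p`), the plus symbol of `f` is non-constant mod `p` on `ℤ[1/p]`: some
`[a/pⁿ]⁺_f − [a'/pⁿ]⁺_f` has `p`-adic norm `≥ 1`.  (Cell memo LINE-VERTICAL-STEVENS-AT-3 §4; no
hypothesis on the image of `ρ̄_f`.) -/
theorem exists_one_le_norm_sub_of_spanMod (hf : IsNewform0 f) (hQ : coeffField f = ⊥)
    (hp2 : p ≠ 2) (hpN : ¬ p ∣ N) {ap : ℤ} (hap : cuspCoeff f p = ap) (hap1 : ¬ (p : ℤ) ∣ ap - 1)
    (hspan : ∀ γ : Gamma0 N, InGammaH N p γ →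
      γ ∈ Subgroup.closure (spanGenerators N p ∪ {g | ∃ h : Gamma0 N, g = h ^ p}) ⊔
        commutator (Gamma0 N)) :
    ∃ (n : ℕ) (a a' : ℤ),
      1 ≤ ‖((ratPlusSymbol f ((a : ℚ) / (p : ℚ) ^ n) - ratPlusSymbol f ((a' : ℚ) / (p : ℚ) ^ n) : ℚ) :
        ℚ_[p])‖ := by
  have hp : p.Prime := Fact.out
  have hreal : ∀ n, (cuspCoeff f n).im = 0 := cuspCoeff_im_eq_zero_of_coeffField_eq_bot hQ
  have hrat : ∀ r : ℚ, (ratPlusSymbol f r : ℝ) = normalizedPlusSymbol f r :=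
    fun r ↦ ratCast_ratPlusSymbol_holds hf hQ r
  have hΩpos : 0 < plusPeriod f := (plusPeriod_pos_and_realPeriods_eq isZLattice_periodLattice_holds hf hQ).1
  have hΩ : plusPeriod f ≠ 0 := hΩpos.ne'
  have hΩ2 : plusPeriod f / 2 ≠ 0 := div_ne_zero hΩ two_ne_zero
  obtain ⟨hre, -⟩ := realPeriods_eq_zmultiples_of_plusPeriod_ne_zero f hΩ
  -- the integer-valued period functional `m`: `re{∞, γ∞} = m(γ)·Ω⁺/2`
  choose m hm using exists_re_cuspSymbol_eq f hre
  have hm_zero : ∀ γ, cuspSymbol f γ = 0 → m γ = 0 := by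
    intro γ h0
    have h := hm γ
    rw [h0, Complex.zero_re] at h
    exact_mod_cast (mul_eq_zero.mp h.symm).resolve_right hΩ2
  have hm_mul : ∀ γ δ, m (γ * δ) = m γ + m δ := by
    intro γ δ
    have h2 : (cuspSymbol f (γ * δ)).re = (cuspSymbol f γ).re + (cuspSymbol f δ).re := by
      rw [cuspSymbol_mul_holds f γ δ, Complex.add_re]
    rw [hm, hm, hm, ← add_mul] at h2
    exact_mod_cast mul_right_cancel₀ hΩ2 h2
  have hm_one : m 1 = 0 := hm_zero 1 (cuspSymbol_one f)
  have hm_inv : ∀ γ, m γ⁻¹ = -m γ := by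
    intro γ
    have h := hm_mul γ γ⁻¹
    rw [mul_inv_cancel, hm_one] at h
    linarith
  have hm_pow : ∀ (γ : Gamma0 N) (n : ℕ), m (γ ^ n) = n * m γ := by
    intro γ n
    induction n with
    | zero => simp [hm_one]
    | succ n ih => rw [pow_succ, hm_mul, ih]; push_cast; ring
  -- symbol identities, in `ℚ`
  have hsub : ∀ (γ : Gamma0 N) (r : ℚ),
      ((γ : SL(2, ℤ)) 1 0 : ℚ) * r + ((γ : SL(2, ℤ)) 1 1 : ℚ) ≠ 0 →
      ratPlusSymbol f
          ((((γ : SL(2, ℤ)) 0 0 : ℚ) * r + ((γ : SL(2, ℤ)) 0 1 : ℚ)) /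
            (((γ : SL(2, ℤ)) 1 0 : ℚ) * r + ((γ : SL(2, ℤ)) 1 1 : ℚ))) -
        ratPlusSymbol f r = (m γ : ℚ) / 2 := by
    intro γ r hr
    have h := ratCast_ratPlusSymbol_moebius_sub f hrat hreal γ r hr
    rw [hm] at h
    have h' : (((ratPlusSymbol f
          ((((γ : SL(2, ℤ)) 0 0 : ℚ) * r + ((γ : SL(2, ℤ)) 0 1 : ℚ)) /
            (((γ : SL(2, ℤ)) 1 0 : ℚ) * r + ((γ : SL(2, ℤ)) 1 1 : ℚ))) -
        ratPlusSymbol f r : ℚ)) : ℝ) = (((m γ : ℚ) / 2 : ℚ) : ℝ) := by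
      push_cast
      rw [h]
      field_simp
    exact_mod_cast h'
  have hinf : ∀ γ : Gamma0 N, ((γ : SL(2, ℤ)) 1 0 : ℤ) ≠ 0 →
      ratPlusSymbol f (((γ : SL(2, ℤ)) 0 0 : ℚ) / ((γ : SL(2, ℤ)) 1 0 : ℚ)) = (m γ : ℚ) / 2 := by
    intro γ hc
    have h := ratCast_ratPlusSymbol_apply_infty f hrat hreal γ hc
    rw [hm] at h
    have h' : ((ratPlusSymbol f (((γ : SL(2, ℤ)) 0 0 : ℚ) / ((γ : SL(2, ℤ)) 1 0 : ℚ)) : ℚ) : ℝ) =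
        (((m γ : ℚ) / 2 : ℚ) : ℝ) := by
      rw [h]; push_cast; field_simp
    exact_mod_cast h'
  -- reduction mod `p` as a homomorphism to the (multiplicatively written) group `ℤ/p`
  let φ : Gamma0 N →* Multiplicative (ZMod p) :=
    { toFun := fun γ ↦ Multiplicative.ofAdd (((m γ : ℤ) : ZMod p))
      map_one' := by simp [hm_one]
      map_mul' := fun γ δ ↦ by simp [hm_mul, ofAdd_add] }
  have hφ : ∀ γ, φ γ = 1 ↔ (p : ℤ) ∣ m γ := by
    intro γ
    simp [φ, ZMod.intCast_zmod_eq_zero_iff_dvd]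
  -- suppose, for contradiction, that every difference has norm `< 1`
  by_contra H
  push Not at H
  -- (1) the span subgroup lies in the kernel
  have hker : Subgroup.closure (spanGenerators N p ∪ {g | ∃ h : Gamma0 N, g = h ^ p}) ⊔
      commutator (Gamma0 N) ≤ φ.ker := by
    refine sup_le ?_ (Abelianization.commutator_subset_ker φ)
    rw [Subgroup.closure_le]
    rintro γ (hγ | ⟨h, rfl⟩)
    · rw [SetLike.mem_coe, MonoidHom.mem_ker, hφ]
      rcases hγ with ⟨k, hk⟩ | hfin | htr | htr
      · -- good: `γ·0 = b/d`, `d = ±p^k`; Manin at `r = 0` and the hypothesis `H`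
        have hd : ((γ : SL(2, ℤ)) 1 1 : ℤ) = (p : ℤ) ^ k ∨ ((γ : SL(2, ℤ)) 1 1 : ℤ) = -((p : ℤ) ^ k) := by
          have := Int.natAbs_eq_iff.mp hk
          push_cast at this
          simpa [dEntry] using this
        have hd0 : ((γ : SL(2, ℤ)) 1 1 : ℚ) ≠ 0 := by
          have hpk : ((p : ℤ) ^ k) ≠ 0 := pow_ne_zero k (by exact_mod_cast hp.ne_zero)
          have : ((γ : SL(2, ℤ)) 1 1 : ℤ) ≠ 0 := by
            rcases hd with hd | hd <;> rw [hd]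
            · exact hpk
            · exact neg_ne_zero.mpr hpk
          exact_mod_cast this
        have h0 := hsub γ 0 (by simpa using hd0)
        simp only [mul_zero, zero_add] at h0
        apply dvd_of_norm_div_two_lt_one hp2
        rw [← h0]
        rcases hd with hd | hd
        · have e : (((γ : SL(2, ℤ)) 0 1 : ℚ)) / ((γ : SL(2, ℤ)) 1 1 : ℚ) =
              ((((γ : SL(2, ℤ)) 0 1 : ℤ) : ℚ)) / (p : ℚ) ^ k := by
            have : (((γ : SL(2, ℤ)) 1 1 : ℤ) : ℚ) = (p : ℚ) ^ k := by rw [hd]; push_cast; rfl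
            rw [← this]
          have := H k ((γ : SL(2, ℤ)) 0 1) 0
          simp only [Int.cast_zero, zero_div] at this
          rwa [e]
        · have e : (((γ : SL(2, ℤ)) 0 1 : ℚ)) / ((γ : SL(2, ℤ)) 1 1 : ℚ) =
              (((-((γ : SL(2, ℤ)) 0 1 : ℤ) : ℤ) : ℚ)) / (p : ℚ) ^ k := by
            have : (((γ : SL(2, ℤ)) 1 1 : ℤ) : ℚ) = -(p : ℚ) ^ k := by rw [hd]; push_cast; rfl
            rw [show (((γ : SL(2, ℤ)) 1 1 : ℚ)) = (((γ : SL(2, ℤ)) 1 1 : ℤ) : ℚ) from rfl, this]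
            push_cast
            rw [div_neg, neg_div]
          have := H k (-((γ : SL(2, ℤ)) 0 1)) 0
          simp only [Int.cast_zero, zero_div] at this
          rwa [e]
      · exact ⟨0, by rw [hm_zero γ (cuspSymbol_eq_zero_of_isOfFinOrder f hfin), mul_zero]⟩
      · exact ⟨0, by rw [hm_zero γ (cuspSymbol_eq_zero_of_trEntry f (Or.inl htr)), mul_zero]⟩
      · exact ⟨0, by rw [hm_zero γ (cuspSymbol_eq_zero_of_trEntry f (Or.inr htr)), mul_zero]⟩
    · -- `p`-th powers
      rw [SetLike.mem_coe, MonoidHom.mem_ker, hφ, hm_pow]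
      exact ⟨m h, by ring⟩
  -- (2) hence `m̄` vanishes on `Γ_H(N)` and is constant on its cosets
  have hH : ∀ γ, InGammaH N p γ → (p : ℤ) ∣ m γ := fun γ hγ ↦ (hφ γ).mp (hker (hspan γ hγ))
  have hcoset : ∀ γ δ : Gamma0 N, InGammaH N p (δ * γ⁻¹) →
      ((m δ : ℤ) : ZMod p) = ((m γ : ℤ) : ZMod p) := by
    intro γ δ h
    have h1 := hH _ h
    rw [hm_mul, hm_inv, ← sub_eq_add_neg] at h1
    rw [← sub_eq_zero, ← Int.cast_sub, ZMod.intCast_zmod_eq_zero_iff_dvd]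
    exact h1
  -- (3) the Hecke step: `m̄ ≡ 0` on all of `Γ₀(N)`
  have hap1' : ((ap - 1 : ℤ) : ZMod p) ≠ 0 := by
    rwa [ne_eq, ZMod.intCast_zmod_eq_zero_iff_dvd]
  have hall : ∀ γ : Gamma0 N, (p : ℤ) ∣ m γ := by
    intro γ
    by_cases hc : ((γ : SL(2, ℤ)) 1 0 : ℤ) = 0
    · have h0 : cuspSymbol f γ = 0 := by simp [cuspSymbol, hc]
      rw [hm_zero γ h0]; exact dvd_zero _
    · have hHecke := intCast_mul_ratPlusSymbol p hf hp hpN hap hrat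
        (((γ : SL(2, ℤ)) 0 0 : ℚ) / ((γ : SL(2, ℤ)) 1 0 : ℚ))
      have hterm := fun j : Fin p ↦ exists_heckeTerm_mem (N := N) (p := p) γ hc ((j : ℕ) : ℤ)
      choose δ hδ0 hδq hδH using hterm
      obtain ⟨δ', hδ'0, hδ'q, hδ'H⟩ := exists_heckeTerm_mem' (N := N) (p := p) hpN γ hc
      have hcQ : (((γ : SL(2, ℤ)) 1 0 : ℤ) : ℚ) ≠ 0 := by exact_mod_cast hc
      have hpQ : (p : ℚ) ≠ 0 := by exact_mod_cast hp.ne_zero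
      have e0 := hinf γ hc
      have ej : ∀ j : Fin p,
          ratPlusSymbol f ((((γ : SL(2, ℤ)) 0 0 : ℚ) / ((γ : SL(2, ℤ)) 1 0 : ℚ) + j) / p) =
            (m (δ j) : ℚ) / 2 := by
        intro j
        rw [← hinf (δ j) (hδ0 j), hδq j]
        congr 1
        push_cast
        field_simp
      have e' : ratPlusSymbol f (p * ((((γ : SL(2, ℤ)) 0 0 : ℚ) / ((γ : SL(2, ℤ)) 1 0 : ℚ)))) =
          (m δ' : ℚ) / 2 := by
        rw [← hinf δ' hδ'0, hδ'q]
      rw [e0, e'] at hHecke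
      simp_rw [ej] at hHecke
      -- `ap · m γ = Σ m(δ j) + m δ'` in `ℤ`
      have hZ : ((ap * m γ : ℤ) : ℚ) = ((∑ j : Fin p, m (δ j) + m δ' : ℤ) : ℚ) := by
        push_cast
        have := hHecke
        rw [← Finset.sum_div] at this
        linear_combination 2 * this
      have hZ' : ap * m γ = ∑ j : Fin p, m (δ j) + m δ' := by exact_mod_cast hZ
      -- reduce mod `p`: every term is `≡ m γ`
      have hmod : ((ap : ℤ) : ZMod p) * ((m γ : ℤ) : ZMod p) =
          ∑ j : Fin p, ((m (δ j) : ℤ) : ZMod p) + ((m δ' : ℤ) : ZMod p) := by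
        have := congrArg (Int.cast : ℤ → ZMod p) hZ'
        push_cast at this
        exact this
      simp_rw [fun j ↦ hcoset γ (δ j) (hδH j), hcoset γ δ' hδ'H, Finset.sum_const, Finset.card_univ,
        Fintype.card_fin] at hmod
      rw [nsmul_eq_mul, ZMod.natCast_self, zero_mul, zero_add] at hmod
      have hzero : ((ap - 1 : ℤ) : ZMod p) * ((m γ : ℤ) : ZMod p) = 0 := by
        push_cast; linear_combination hmod
      rw [← ZMod.intCast_zmod_eq_zero_iff_dvd]
      exact (mul_eq_zero.mp hzero).resolve_left hap1'
  -- (4) contradiction with the primitivity of the period functional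
  exact not_forall_dvd_of_realPeriods f hre hΩ hp.one_lt hm hall

end Bridge

section Consequences

variable {N : ℕ} {p : ℕ}

/-- **EIS-SPAN ⟹ mod-`p` span** (Bezout: `γ = (γᵐ)ᵘ·(γᵖ)ᵛ` with `um + vp = 1`; referee R-68's
`eisSpanModGen_of_eisSpanGen`, re-proved here over the tree carrier). -/
theorem spanMod_of_eisSpanGen (hp : p.Prime) (h : EisSpanGen N p) (γ : Gamma0 N)
    (hγ : InGammaH N p γ) :
    γ ∈ Subgroup.closure (spanGenerators N p ∪ {g | ∃ h : Gamma0 N, g = h ^ p}) ⊔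
      commutator (Gamma0 N) := by
  obtain ⟨m, hm, hmem⟩ := h γ hγ
  set K : Subgroup (Gamma0 N) :=
    Subgroup.closure (spanGenerators N p ∪ {g | ∃ h : Gamma0 N, g = h ^ p}) ⊔ commutator (Gamma0 N)
    with hK
  have hmono : Subgroup.closure (spanGenerators N p) ⊔ commutator (Gamma0 N) ≤ K :=
    sup_le_sup_right (Subgroup.closure_mono Set.subset_union_left) _
  have h1 : γ ^ m ∈ K := hmono hmem
  have h2 : γ ^ p ∈ K :=
    Subgroup.mem_sup_left (Subgroup.subset_closure (Set.mem_union_right _ ⟨γ, rfl⟩))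
  have hcop : Nat.Coprime m p := Nat.coprime_comm.mp ((Nat.Prime.coprime_iff_not_dvd hp).mpr hm)
  have hbez : (m : ℤ) * Nat.gcdA m p + (p : ℤ) * Nat.gcdB m p = 1 := by
    have := Nat.gcd_eq_gcd_ab m p
    rw [hcop] at this
    exact_mod_cast this.symm
  have key : γ = (γ ^ m) ^ Nat.gcdA m p * (γ ^ p) ^ Nat.gcdB m p := by
    rw [← zpow_natCast, ← zpow_natCast, ← _root_.zpow_mul, ← _root_.zpow_mul, ← _root_.zpow_add, hbez,
      zpow_one]
  rw [key]
  exact K.mul_mem (K.zpow_mem h1 _) (K.zpow_mem h2 _)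

variable [NeZero N] {f : CuspForm (Gamma0 N) 2} [Fact p.Prime]

/-- **THE BRIDGE from EIS-SPAN(N,p)** (ty2's `EisSpanGen`, the planner's VS-0 shape at level `N`):
`EisSpanGen N p`, `p` odd, `p ∤ N`, `a_p(f) ≢ 1 (mod p)` ⟹ `[·]⁺_f` is non-constant mod `p` on `ℤ[1/p]`. -/
theorem exists_one_le_norm_sub_of_eisSpanGen (hf : IsNewform0 f) (hQ : coeffField f = ⊥)
    (hp2 : p ≠ 2) (hpN : ¬ p ∣ N) {ap : ℤ} (hap : cuspCoeff f p = ap) (hap1 : ¬ (p : ℤ) ∣ ap - 1)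
    (hE : EisSpanGen N p) :
    ∃ (n : ℕ) (a a' : ℤ),
      1 ≤ ‖((ratPlusSymbol f ((a : ℚ) / (p : ℚ) ^ n) - ratPlusSymbol f ((a' : ℚ) / (p : ℚ) ^ n) : ℚ) :
        ℚ_[p])‖ :=
  exists_one_le_norm_sub_of_spanMod hf hQ hp2 hpN hap hap1 (spanMod_of_eisSpanGen Fact.out hE)

/-- **THE BRIDGE from CONJ-SPAN(N,p)** (`ConjSpanGen`, the integral form; THEOREM (T) supplies it at
prime level). -/
theorem exists_one_le_norm_sub_of_conjSpanGen (hf : IsNewform0 f) (hQ : coeffField f = ⊥)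
    (hp2 : p ≠ 2) (hpN : ¬ p ∣ N) {ap : ℤ} (hap : cuspCoeff f p = ap) (hap1 : ¬ (p : ℤ) ∣ ap - 1)
    (hC : ConjSpanGen N p) :
    ∃ (n : ℕ) (a a' : ℤ),
      1 ≤ ‖((ratPlusSymbol f ((a : ℚ) / (p : ℚ) ^ n) - ratPlusSymbol f ((a' : ℚ) / (p : ℚ) ^ n) : ℚ) :
        ℚ_[p])‖ :=
  exists_one_le_norm_sub_of_eisSpanGen hf hQ hp2 hpN hap hap1
    (eisSpanGen_of_conjSpanGen (Nat.Prime.one_lt Fact.out).ne' hC)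

end Consequences

end Summit.BirchSwinnertonDyer.BirchSwinnertonDyer.Theorems.PrintX8VerticalStevens

end
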